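import Mathlib
import HarnessLib
import Literature.MathematicalPhysics.StatisticalMechanics.AbkmPackageSlots
import Literature.MathematicalPhysics.StatisticalMechanics.AbkmTwoKernelHolderPair
import Literature.MathematicalPhysics.StatisticalMechanics.FluctuationKernelComparisonConnGeomTorusFRD
import Literature.MathematicalPhysics.StatisticalMechanics.FluctuationKernelComparisonNearTorusFRD

/-!
# [ABKM19] Lemma 8.4 (`ℓ = 1`) for EVERY package: the two `N`-free pair-property suppliers of the two-kernel comparison of `S_k`
# (connected `k`-polymers with per-block constant `(1+ε)²A_𝒫'`; `k`-polymers near a connected `(k+1)`-polymer `U`)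

The kernel-level two-kernel bound of the RG step (`RenormalisationMapTwoKernelWeak.weakNormLE_nextKStep_kernel_sub_abkm_of_stepKernelBounds`,
line `banach_two_kernel` of the child `TwoKernelSkBound` of the cruxes `HypACumulant` / `HypALocalTwoPoint`, route
`Summits/HubbardSuperconductivity/…/Theses/ComplexGFFStiffness`) consumes the pair property `‖(R_{q'} − R_q)F‖_{k:k+1,X} ≤ …` in two shapes:
`C·ℓ_c·κ_c^{|X|_k}` on connected `k`-polymers and `b·ℓ_n(U)·κ_p^{|Y|_k}` on the `k`-polymers inside `U + [−(2^d−1)L^k, …]^d`.  This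
file discharges both from the fields of a package `P : PackageData d` (the clauses of `PackageAt`), ONCE, with `N`-free data: the
Hölder pair of `exists_holderPair_weightIntConstRho_le_one_add_mul` (per-block constant `κ_p ≤ (1+ε)A_𝒫'`, any `ε > 0`), the
geometric absorption of the polynomial of the connected supplier (`tayNormLE_fluct_sub_fluct_conn_geom_of_torusFRD`, base `(1+ε)κ_p`)
and the near-`U` supplier (`tayNormLE_fluct_sub_fluct_near_of_torusFRD`, factor polynomial in `|U|_{k+1}` kept explicit), with
`|q'−q|₁ e^{2K|q'−q|₁} ≤ |q'−q|₁ e^{2K}` on the ball: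

* **`PackageData.exists_pairSuppliers`**.

Everything is proved; no named fact.  Nothing about superconductivity in the Hubbard model.

## References
* S. Adams, S. Buchholz, R. Kotecký, S. Müller, arXiv:1910.13564, Lemma 8.4, Lemma 12.6 (12.53) [AdamsBuchholzKoteckyMuller2019].
* S. Buchholz, J. Funct. Anal. 275 (2018), Thm 4.5 [Buchholz2016].
-/

noncomputable section

namespace Literature.MathematicalPhysics.StatisticalMechanics.GradientRG

open scoped BigOperators Classical
open Finset Filter Topology
open Literature.MathematicalPhysics.StatisticalMechanics.TorusPolymer (IsPolymer numBlocks thicken blocks)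
open Literature.Barriers.CriticalPhenomena.LongRangePhi4.Polymer (IsConn)

variable {d : ℕ}

/-- `sup_n n^k r^n < ∞` for `0 ≤ r < 1` (private helper). [folklore] -/
private theorem exists_nat_pow_mul_pow_le' {r : ℝ} (hr0 : 0 ≤ r) (hr : r < 1) (k : ℕ) :
    ∃ C : ℝ, 0 < C ∧ ∀ n : ℕ, (n : ℝ) ^ k * r ^ n ≤ C := by
  have habs : |r| < 1 := abs_lt.2 ⟨by linarith, hr⟩
  have ht := tendsto_pow_const_mul_const_pow_of_abs_lt_one k habs
  have hev : ∀ᶠ n : ℕ in atTop, (n : ℝ) ^ k * r ^ n < 1 := ht.eventually (gt_mem_nhds zero_lt_one)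
  obtain ⟨N, hN⟩ := Filter.eventually_atTop.1 hev
  refine ⟨1 + ∑ n ∈ Finset.range N, (n : ℝ) ^ k * r ^ n, ?_, ?_⟩
  · have : 0 ≤ ∑ n ∈ Finset.range N, (n : ℝ) ^ k * r ^ n := Finset.sum_nonneg fun n _ => by positivity
    linarith
  · intro n
    by_cases hn : N ≤ n
    · have h1 := hN n hn
      have : 0 ≤ ∑ m ∈ Finset.range N, (m : ℝ) ^ k * r ^ m := Finset.sum_nonneg fun m _ => by positivity
      linarith
    · have hmem : n ∈ Finset.range N := Finset.mem_range.2 (by omega)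
      have hle : (n : ℝ) ^ k * r ^ n ≤ ∑ m ∈ Finset.range N, (m : ℝ) ^ k * r ^ m :=
        Finset.single_le_sum (f := fun m : ℕ => (m : ℝ) ^ k * r ^ m) (fun m _ => by positivity) hmem
      linarith

/-- `(n + c)^k ≤ C g^n` for `g > 1`, `c ≥ 0` (private helper: polynomial absorbed by a geometric factor). [folklore] -/
private theorem exists_nat_add_pow_le_mul_pow {g c : ℝ} (hg : 1 < g) (hc : 0 ≤ c) (k : ℕ) :
    ∃ C : ℝ, 0 < C ∧ ∀ n : ℕ, ((n : ℝ) + c) ^ k ≤ C * g ^ n := by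
  have hg0 : 0 < g := by linarith
  obtain ⟨C₀, hC₀, hb⟩ := exists_nat_pow_mul_pow_le' (inv_nonneg.2 hg0.le) (inv_lt_one_of_one_lt₀ hg) k
  refine ⟨(1 + c) ^ k * (g * C₀), by positivity, fun n => ?_⟩
  have h1 : (n : ℝ) + c ≤ (1 + c) * ((n : ℝ) + 1) := by
    have hn : (0 : ℝ) ≤ n := Nat.cast_nonneg n
    nlinarith
  have h0 : 0 ≤ (n : ℝ) + c := by positivity
  have hpow : ((n : ℝ) + c) ^ k ≤ (1 + c) ^ k * ((n : ℝ) + 1) ^ k := by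
    rw [← mul_pow]; exact pow_le_pow_left₀ h0 h1 k
  have hnext := hb (n + 1)
  push_cast at hnext
  -- `(n+1)^k g^{-(n+1)} ≤ C₀` ⇒ `(n+1)^k ≤ C₀ g^{n+1} = (g C₀) g^n`
  have hgn : 0 < g ^ (n + 1) := pow_pos hg0 _
  have key : ((n : ℝ) + 1) ^ k ≤ g * C₀ * g ^ n := by
    have e : ((n : ℝ) + 1) ^ k = (((n : ℝ) + 1) ^ k * g⁻¹ ^ (n + 1)) * g ^ (n + 1) := by
      rw [mul_assoc, ← mul_pow, inv_mul_cancel₀ hg0.ne', one_pow, mul_one]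
    rw [e]
    calc ((n : ℝ) + 1) ^ k * g⁻¹ ^ (n + 1) * g ^ (n + 1) ≤ C₀ * g ^ (n + 1) :=
          mul_le_mul_of_nonneg_right hnext hgn.le
      _ = g * C₀ * g ^ n := by rw [pow_succ]; ring
  calc ((n : ℝ) + c) ^ k ≤ (1 + c) ^ k * ((n : ℝ) + 1) ^ k := hpow
    _ ≤ (1 + c) ^ k * (g * C₀ * g ^ n) := mul_le_mul_of_nonneg_left key (by positivity)
    _ = (1 + c) ^ k * (g * C₀) * g ^ n := by ring

/-- `√y ≤ 1 + y` for `y ≥ 0` (private helper). [folklore] -/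
private theorem sqrt_le_one_add {y : ℝ} (hy : 0 ≤ y) : Real.sqrt y ≤ 1 + y := by
  rw [Real.sqrt_le_left (by linarith)]
  nlinarith

namespace PackageData

set_option maxHeartbeats 800000 in
/-- **The two pair-property suppliers of a package, `N`-free** (module docstring): for every `ε > 0` there are `N`-free
`ℓ_c, ℓ_n, κ_p ≥ 0` with `κ_p ≤ (1+ε)·A_𝒫'` such that for every height `N`, every `q, q'` in the tuning ball and every `k + 1 ≤ N`:
(conn) for every connected `k`-polymer `X` and every `T_k^{X*}`-local `C^{r₀}` functional `F` with `‖F‖_{k,X} ≤ b`,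
`‖(R_{q'} − R_q)F‖_{k:k+1,X} ≤ b·(ℓ_c|q'−q|₁)·((1+ε)κ_p)^{|X|_k}`; (near) for every connected `(k+1)`-polymer `U`, every `k`-polymer
`Y ⊆ U + [−(2^d−1)L^k, …]^d` and every such `F` on `Y`,
`‖(R_{q'} − R_q)F‖_{k:k+1,Y} ≤ b·(ℓ_n|q'−q|₁·(3^{d+1}(2(L|U|_{k+1} + 2(2^{d+1}+R) + 2p_Φ + 1))^d)^{1/2})·κ_p^{|Y|_k}`.
[cite: AdamsBuchholzKoteckyMuller2019, Lemma 8.4 / Lemma 12.6 (12.53)] -/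
theorem exists_pairSuppliers (P : PackageData d) [Fact (0 < P.h)] [Fact (0 < P.L)] {ε : ℝ} (hε : 0 < ε) :
    ∃ ℓc ℓn κp : ℝ, 0 ≤ ℓc ∧ 0 ≤ ℓn ∧ 0 ≤ κp ∧ κp ≤ (1 + ε) * P.A𝒫' ∧
      ∀ (N M : ℕ) [NeZero M] (Q : PackageAt P N M) (q q' : Matrix (Fin d) (Fin d) ℝ),
        P.InBall q → P.InBall q' → ∀ k, k + 1 ≤ N →
        (∀ X : Finset (Fin d → ZMod M), IsPolymer (P.L ^ k) X → IsConn X →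
          ∀ (F : ((Fin d → ZMod M) → ℝ) → ℂ) (b : ℝ), 0 ≤ b → ContDiff ℝ P.r₀ F →
            IsGaugeLocal (Q.normParams.gauge k X) F →
            TayNormLE (Q.normParams.gauge k X) P.r₀
              ((abkmWeightData P.L N P.Mord P.R P.θbar (schedDelta P.δ₀ P.δ₁ N) fun j => Q.𝒞 1 j).weight k X) F b →
            TayNormLE (Q.normParams.gauge k X) P.r₀
              ((abkmWeightData P.L N P.Mord P.R P.θbar (schedDelta P.δ₀ P.δ₁ N) fun j => Q.𝒞 1 j).midWeight k X)
              (fluct (Q.kernels q' (k + 1)) F - fluct (Q.kernels q (k + 1)) F)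
              (b * (ℓc * esum (q' - q)) * ((1 + ε) * κp) ^ numBlocks (P.L ^ k) X)) ∧
        (∀ U : Finset (Fin d → ZMod M), IsPolymer (P.L ^ (k + 1)) U → IsConn U →
          ∀ X : Finset (Fin d → ZMod M), IsPolymer (P.L ^ k) X → X ⊆ thicken ((2 ^ d - 1) * P.L ^ k) U →
          ∀ (F : ((Fin d → ZMod M) → ℝ) → ℂ) (b : ℝ), 0 ≤ b → ContDiff ℝ P.r₀ F →
            IsGaugeLocal (Q.normParams.gauge k X) F →
            TayNormLE (Q.normParams.gauge k X) P.r₀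
              ((abkmWeightData P.L N P.Mord P.R P.θbar (schedDelta P.δ₀ P.δ₁ N) fun j => Q.𝒞 1 j).weight k X) F b →
            TayNormLE (Q.normParams.gauge k X) P.r₀
              ((abkmWeightData P.L N P.Mord P.R P.θbar (schedDelta P.δ₀ P.δ₁ N) fun j => Q.𝒞 1 j).midWeight k X)
              (fluct (Q.kernels q' (k + 1)) F - fluct (Q.kernels q (k + 1)) F)
              (b * (ℓn * esum (q' - q) *
                Real.sqrt ((3 : ℝ) ^ (d + 1) *
                  ((2 * (P.L * numBlocks (P.L ^ (k + 1)) U + 2 * (2 ^ (d + 1) + P.R) + 2 * P.pT + 1) : ℕ) : ℝ) ^ d)) *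
                κp ^ numBlocks (P.L ^ k) X)) := by
  -- the Hölder pair: `κp = A𝒫(ρ'')^{1/p} ≤ (1+ε) A𝒫'`
  set c₁ := traceConst d P.Mord P.R P.lam (derivSum d P.n fun θ' _ => P.Cα θ' 0) with hc₁
  have hc₁0 : 0 ≤ c₁ := traceConst_nonneg d P.Mord P.R P.hlam.le (derivSum_nonneg d P.n _)
  obtain ⟨p, qH, ρ'', hpq, hρ''0, hρ''bar, -, hpρ, hWε⟩ :=
    exists_holderPair_weightIntConstRho_le_one_add_mul (c₁ := c₁) P.hθbar P.hθ0 P.hθ hc₁0 hε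
  set κp := weightIntConstRho P.θbar ρ'' c₁ ^ (1 / p) with hκpdef
  have hW0 : 0 ≤ weightIntConstRho P.θbar ρ'' c₁ :=
    zero_le_one.trans (one_le_weightIntConstRho P.hθbar hρ''0 hρ''bar hc₁0)
  have hκp0 : 0 ≤ κp := Real.rpow_nonneg hW0 _
  have hκpε : κp ≤ (1 + ε) * P.A𝒫' := by rw [← P.hA𝒫']; exact hWε
  have hqH0 : 0 ≤ qH := le_of_lt (lt_trans one_pos hpq.symm.lt)
  -- the geometric absorption of the polynomial of the connected supplier, base `g = 1 + ε`
  have hg1 : (1 : ℝ) < 1 + ε := by linarith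
  set c₀ : ℝ := ((2 * (2 ^ d + P.R) + 2 * P.pT + 1 : ℕ) : ℝ) with hc₀
  have hc₀0 : 0 ≤ c₀ := Nat.cast_nonneg _
  obtain ⟨C₀, hC₀, hC₀b⟩ := exists_nat_add_pow_le_mul_pow hg1 hc₀0 d
  set Cg : ℝ := (1 + (3 : ℝ) ^ (d + 1) * (2 : ℝ) ^ d) * C₀ with hCg
  have hCg0 : 0 ≤ Cg := by positivity
  have habs : ∀ m : ℕ, Real.sqrt ((3 : ℝ) ^ (d + 1) * ((2 * (m + 2 * (2 ^ d + P.R) + 2 * P.pT + 1) : ℕ) : ℝ) ^ d) ≤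
      Cg * (1 + ε) ^ m := by
    intro m
    have hcast : ((2 * (m + 2 * (2 ^ d + P.R) + 2 * P.pT + 1) : ℕ) : ℝ) = 2 * ((m : ℝ) + c₀) := by
      rw [hc₀]; push_cast; ring
    rw [hcast, mul_pow]
    have hy0 : 0 ≤ (3 : ℝ) ^ (d + 1) * ((2 : ℝ) ^ d * ((m : ℝ) + c₀) ^ d) := by positivity
    refine (sqrt_le_one_add hy0).trans ?_
    have h1 := hC₀b m
    have hg0 : (1 : ℝ) ≤ (1 + ε) ^ m := one_le_pow₀ (by linarith)
    have hmc1 : ((m : ℝ) + c₀) ^ d ≤ C₀ * (1 + ε) ^ m := h1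
    calc 1 + (3 : ℝ) ^ (d + 1) * ((2 : ℝ) ^ d * ((m : ℝ) + c₀) ^ d)
        ≤ C₀ * (1 + ε) ^ m + (3 : ℝ) ^ (d + 1) * ((2 : ℝ) ^ d * (C₀ * (1 + ε) ^ m)) := by
          have : (1 : ℝ) ≤ C₀ * (1 + ε) ^ m := by
            have h2 := hC₀b 0
            simp only [Nat.cast_zero, zero_add, pow_zero, mul_one] at h2
            have hc1 : (1 : ℝ) ≤ C₀ := by
              have : (0 : ℝ) < c₀ ^ d ∨ c₀ ^ d = 0 := by
                rcases eq_or_lt_of_le (pow_nonneg hc₀0 d) with h | h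
                · exact Or.inr h.symm
                · exact Or.inl h
              -- `c₀ ≥ 1`, so `c₀^d ≥ 1` and `C₀ ≥ c₀^d ≥ 1`
              have hc₀1 : (1 : ℝ) ≤ c₀ := by
                rw [hc₀]; exact_mod_cast (show 1 ≤ 2 * (2 ^ d + P.R) + 2 * P.pT + 1 by omega)
              exact (one_le_pow₀ hc₀1).trans h2
            nlinarith
          nlinarith [mul_le_mul_of_nonneg_left hmc1 (by positivity : (0 : ℝ) ≤ (3 : ℝ) ^ (d + 1) * (2 : ℝ) ^ d)]
      _ = Cg * (1 + ε) ^ m := by rw [hCg]; ring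
  -- the `N`-free constants
  have hL0 : (0 : ℝ) < P.L := by exact_mod_cast P.hLodd.pos
  set Ksh := shellRatioConst P.c (P.Cℓ 1) (P.L : ℝ) d P.ñ with hKsh
  have hKsh0 : 0 ≤ Ksh := shellRatioConst_nonneg P.hc P.hC1 hL0.le d P.ñ
  set ℓ₁ := ((P.r₀ : ℝ) + 1) * (8 * qH * (Real.exp (2 * Ksh) * Ksh)) with hℓ₁
  have hℓ₁0 : 0 ≤ ℓ₁ := by positivity
  refine ⟨ℓ₁ * Cg, ℓ₁, κp, by positivity, hℓ₁0, hκp0, hκpε, ?_⟩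
  intro N M _ Q q q' hq hq' k hk
  -- `|q'−q|₁ ≤ 1`, so `e^{2K|q'−q|₁} ≤ e^{2K}`
  set t := esum (q' - q) with htdef
  have ht0 : 0 ≤ t := entrySum_nonneg _
  have ht1 : t ≤ 1 := by
    have h1 : esum (q' - q) ≤ esum q' + esum q := by
      unfold esum
      rw [← Finset.sum_add_distrib]
      refine Finset.sum_le_sum fun i _ => ?_
      rw [← Finset.sum_add_distrib]
      refine Finset.sum_le_sum fun j _ => ?_
      rw [Matrix.sub_apply]
      exact abs_sub _ _
    have h2 : esum q' ≤ P.T₀ := hq'.2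
    have h3 : esum q ≤ P.T₀ := hq.2
    linarith [P.hT₀]
  have hexp : Real.exp (2 * Ksh * t) ≤ Real.exp (2 * Ksh) := by
    apply Real.exp_le_exp.2; nlinarith
  have hEK : t * Real.exp (2 * Ksh * t) * Ksh ≤ t * (Real.exp (2 * Ksh) * Ksh) := by
    rw [mul_assoc]; exact mul_le_mul_of_nonneg_left (mul_le_mul_of_nonneg_right hexp hKsh0) ht0
  have hE0 : 0 ≤ t * Real.exp (2 * Ksh * t) * Ksh := by positivity
  refine ⟨fun X hX hXc F b hb hFd hFloc hF => ?_, fun U hU hUc X hX hXU F b hb hFd hFloc hF => ?_⟩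
  · -- connected polymers, geometric form
    have hconn := tayNormLE_fluct_sub_fluct_conn_geom_of_torusFRD (pT := P.pT) (r₀ := P.r₀) (h := P.h) (A := P.A) P.hd
      P.hMord P.hMR P.hLodd P.hL Q.hM P.hθbar P.hlam P.hn P.hn2 P.hnñ P.hgap P.hc P.hC1 Q.hallA Q.hB hk P.hθ0 P.hθ P.hT₀
      P.hKT₀ hq.1 hq'.1 hq.2 hq'.2 hpq hρ''0 hρ''bar hpρ hX hXc habs hb hFd hFloc hF
    refine hconn.mono ?_ (fun φ => ((abkmWeightData P.L N P.Mord P.R P.θbar (schedDelta P.δ₀ P.δ₁ N)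
      fun j => Q.𝒞 1 j).midWeight_pos k X φ).le)
    have hbase0 : 0 ≤ ((1 + ε) * κp) ^ numBlocks (P.L ^ k) X := pow_nonneg (by positivity) _
    refine mul_le_mul_of_nonneg_right ?_ hbase0
    refine mul_le_mul_of_nonneg_left ?_ hb
    -- `(r₀+1)(8qH(Cg·(t e^{2Kt} K))) ≤ ℓ₁ Cg t`
    have h1 := mul_le_mul_of_nonneg_left hEK hCg0
    calc ((P.r₀ : ℝ) + 1) * (8 * qH * (Cg * (t * Real.exp (2 * Ksh * t) * Ksh)))
        ≤ ((P.r₀ : ℝ) + 1) * (8 * qH * (Cg * (t * (Real.exp (2 * Ksh) * Ksh)))) := by gcongr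
      _ = ℓ₁ * Cg * t := by rw [hℓ₁]; ring
  · -- polymers near `U`
    have hnear := tayNormLE_fluct_sub_fluct_near_of_torusFRD (pT := P.pT) (r₀ := P.r₀) (h := P.h) (A := P.A) P.hd
      P.hMord P.hMR P.hLodd P.hL Q.hM P.hθbar P.hlam P.hn P.hn2 P.hnñ P.hgap P.hc P.hC1 Q.hallA Q.hB hk P.hθ0 P.hθ P.hT₀
      P.hKT₀ hq.1 hq'.1 hq.2 hq'.2 hpq hρ''0 hρ''bar hpρ hUc hX hXU hb hFd hFloc hF
    refine hnear.mono ?_ (fun φ => ((abkmWeightData P.L N P.Mord P.R P.θbar (schedDelta P.δ₀ P.δ₁ N)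
      fun j => Q.𝒞 1 j).midWeight_pos k X φ).le)
    have hbase0 : 0 ≤ κp ^ numBlocks (P.L ^ k) X := pow_nonneg hκp0 _
    refine mul_le_mul_of_nonneg_right ?_ hbase0
    refine mul_le_mul_of_nonneg_left ?_ hb
    set S := Real.sqrt ((3 : ℝ) ^ (d + 1) *
      ((2 * (P.L * numBlocks (P.L ^ (k + 1)) U + 2 * (2 ^ (d + 1) + P.R) + 2 * P.pT + 1) : ℕ) : ℝ) ^ d) with hS
    have hS0 : 0 ≤ S := Real.sqrt_nonneg _
    have h1 := mul_le_mul_of_nonneg_left hEK hS0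
    calc ((P.r₀ : ℝ) + 1) * (8 * qH * (S * (t * Real.exp (2 * Ksh * t) * Ksh)))
        ≤ ((P.r₀ : ℝ) + 1) * (8 * qH * (S * (t * (Real.exp (2 * Ksh) * Ksh)))) := by gcongr
      _ = ℓ₁ * t * S := by rw [hℓ₁]; ring

end PackageData

end Literature.MathematicalPhysics.StatisticalMechanics.GradientRG

end
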